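import Summits.CriticalPhenomena.Ising3DConformalLimit.Theses.UnitLightCone
import Summits.CriticalPhenomena.Ising3DConformalLimit.Theorems.HyperoctahedralRPTwoPointLimitIsotropicHolds
import HarnessLib

/-!
# Line `intree-transfer` — crux `UnitLightCone.LightConeRoundness` (item stmt-CriticalPhenomena-17169)

Route `route-CriticalPhenomena-UnitLightCone` (sub `Ising3DConformalLimit`), crux rank 7:
`Summit.CriticalPhenomena.Ising3DConformalLimit.Theses.UnitLightCone.LightConeRoundness` — for every
normalised, non-degenerate, translation-invariant, scale-covariant pointwise scaling limit `S` of
`criticalCorr 3`, unit-light-cone Källén–Lehmann representations of `x ↦ S 2 (0, x)` in the frames `e₃` and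
`(e₁+e₂)/√2` imply `S 2 (0, R x) = S 2 (0, x)` for every linear isometry `R` of `ℝ³`.

## Finding of the crux-strategist (planner-cstrat-stmt-CriticalPhenomena-17169-b1-0, 2026-08-17)

THE CRUX IS PROVABLE NOW, WITH ZERO STUBS — census lens `transfer`: the solved sibling's version of exactly
this step is route HyperoctahedralRP's milestone `TwoPointLimitIsotropic` (item stmt-CriticalPhenomena-1984,
CLOSED · proved 2026-08-16: crux `HRP2Rigidity` (stmt-1979, line `xray-mellin-transfer`) composed with the
glue `twoPointKernelOfLimit_proof` (stmt-1983)), whose unguarded corollary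
`Summit.CriticalPhenomena.Ising3DConformalLimit.HyperoctahedralRPTwoPoint.kernel_rotation_invariant`
(`Theorems/HyperoctahedralRPTwoPointLimitIsotropicHolds.lean`) is the conclusion of this crux under a SUBSET
of its hypotheses (it needs neither the normalisation off `NonCoincident` nor the two Källén–Lehmann
representations). The transferring argument breaks NOWHERE: the sibling statement is the stronger one.

This file is therefore a 0-stub, sorry-free skeleton: `LightConeRoundness_of` concludes the crux BY NAME
(type literally the route decl) from the landed theorem; `LightConeRoundness_of_twoPointLimitIsotropic`
records the reduction to the sibling ITEM decl `HyperoctahedralRP.TwoPointLimitIsotropic` (guard `x ≠ 0`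
discharged at `x = 0` by `R 0 = 0`). Re-verified against the current tree: `lean check --json` rc 0,
errors [], sorries 0; axiom closure of the proof = [propext, Classical.choice, Quot.sound] (asserted
in-Lean via `Lean.collectAxioms` in the seat's `AxiomsCheck.lean`).

ACTION FOR A PROVER (planner seats bounce with `perm.theorems-prover-only`, dry-run confirmed): land the
attached evidence file `UnitLightConeLightConeRoundness.lean` (theorem `lightConeRoundness_proof`, this proof
term) with `ledger propose --kind proof --target
Summits/CriticalPhenomena/Ising3DConformalLimit/Theorems/UnitLightConeLightConeRoundness.lean --file … --workitem
stmt-CriticalPhenomena-17169`.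

Relation to the other registered line `Lines/birth.lean` (2 stubs, planner-skel seat): `birth` is the route's
OWN light-cone mechanism (unit cone in one axis frame ⇒ transverse isotropy via Paley–Wiener on complexified
latitudes; then cubic closing geometry) — an independent second proof, model-blind and valid on the wider
window `0 < Δ < 2` without reflection positivity; it is mathematics worth keeping but NOT an obligation of
this item. A lead seated on this crux should take `intree-transfer` (minutes), not `birth` (size L).

Disproof used: none exists (`ledger crux ls stmt-CriticalPhenomena-17169`: only `Lines/birth.*`; payload
`disproof_path` absent on disk; no `Theorems/LightConeRoundness/Negative/*`). Negatives index: no light-cone /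
Källén–Lehmann / isotropy statement among the summit's refuted items.
-/

namespace Summit.CriticalPhenomena.Ising3DConformalLimit.Cruxes.LightConeRoundness.IntreeTransfer

open Summit.CriticalPhenomena.Ising3DConformalLimit.HyperoctahedralRPTwoPoint

/-- Reduction to the sibling ITEM (census `## Transfer`): HyperoctahedralRP's milestone
`TwoPointLimitIsotropic` (stmt-CriticalPhenomena-1984, proved; isotropy of the limit two-point kernel off the
origin) implies `LightConeRoundness` — drop the normalisation and the two Källén–Lehmann hypotheses, and treat
`x = 0` by `R 0 = 0`. [folklore] -/
theorem LightConeRoundness_of_twoPointLimitIsotropic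
    (h : _root_.Summit.CriticalPhenomena.Ising3DConformalLimit.Theses.HyperoctahedralRP.TwoPointLimitIsotropic) :
    _root_.Summit.CriticalPhenomena.Ising3DConformalLimit.Theses.UnitLightCone.LightConeRoundness := by
  intro ρ Δ S hρ hlim _hnorm hnd htr hsc _hax _hdg R x
  by_cases hx : x = 0
  · subst hx
    simp
  · exact h ρ Δ S hρ hlim hnd htr hsc R x hx

/-- **`LightConeRoundness_of` — the crux BY NAME, sorry-free, zero stubs**, from the landed theorem
`kernel_rotation_invariant` (two-point isotropy of the critical `ℤ³` Ising scaling limit at every point).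
[folklore] -/
theorem LightConeRoundness_of :
    _root_.Summit.CriticalPhenomena.Ising3DConformalLimit.Theses.UnitLightCone.LightConeRoundness := by
  intro ρ Δ S hρ hlim _hnorm hnd htr hsc _hax _hdg R x
  exact kernel_rotation_invariant hρ hlim hnd htr hsc R x

/-- The same conclusion through the sibling item decl (checks that the reduction composes with the landed
milestone `twoPointLimitIsotropic_proof`). [folklore] -/
theorem LightConeRoundness_of' :
    _root_.Summit.CriticalPhenomena.Ising3DConformalLimit.Theses.UnitLightCone.LightConeRoundness :=
  LightConeRoundness_of_twoPointLimitIsotropic twoPointLimitIsotropic_proof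

end Summit.CriticalPhenomena.Ising3DConformalLimit.Cruxes.LightConeRoundness.IntreeTransfer
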